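import Mathlib
import HarnessLib
import Literature.MathematicalPhysics.QuantumLattice.HubbardFreeTorusGroundEnergy

/-!
# Route `WeakCouplingBCS` — crux `WcbcsBcsConstruction` (stmt-HubbardSuperconductivity-2010),
# line `lro-seed-kink-bridge`, stub `stub_freeSourcedGroundEnergy`

The FREE (`U = 0`) sourced grand-canonical ground energy of the `d`-wave-sourced Hubbard torus
`dWaveSourceTorus L 0 μ s = hubbardTorusWith 2 L 1 0 μ - s (Δ_d + Δ_d†)` on `(ℤ/Lℤ)²`, `L ≥ 3`, in
closed (BdG) form:

`E₀(dWaveSourceTorus L 0 μ s) = Σ_{k ∈ (ℤ/Lℤ)²} (ξ_k - E_k)`,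
`ξ_k = ε_L(k) - μ`, `E_k = √(ξ_k² + 8 s² ĝ_d(k)²)`.

This is the calibration input ("the top stairs are free-gas stairs") of the line: at `s = 0` it is
`Σ_k (ξ_k - |ξ_k|) = 2 Σ_k min(ξ_k, 0)`, the tree's `groundEnergy_hubbardTorusWith_zero`.

Proof (folklore `β → ∞` in the BdG partition function of [von Delft–Ralph 2001, §4.2], exactly as the
tree's `groundEnergy_hubbardTorusWith_zero` does at `s = 0`). The tree has
`Re Z_β = 2^{2L²} Π_k e^{-βξ_k} (1 + cosh βE_k)/2` (`partitionFn_dWaveSourceTorus_zero_re`). Per mode,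
`e^{y}/4 ≤ (1 + cosh y)/2 ≤ e^{y}` for `y = βE_k ≥ 0`, so
`log Re Z_β ∈ [2L² log 2 - β Σ_k (ξ_k - E_k) - L² log 4, 2L² log 2 - β Σ_k (ξ_k - E_k)]`; with
`e^{-βE₀} ≤ Re Z_β ≤ 4^{L²} e^{-βE₀}` (`LiebFluxPhaseProofs`) this gives
`|E₀ - Σ_k (ξ_k - E_k)| ≤ 2L² log 2 / β` for every `β > 0`, hence equality.
-/

noncomputable section

set_option linter.dupNamespace false

namespace Summit.HubbardSuperconductivity.HubbardSuperconductivity.Theorems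

open Literature.MathematicalPhysics.QuantumLattice Literature.Probability.LatticeModels Matrix Filter
open scoped Matrix.Norms.L2Operator ComplexOrder Topology

/-- The BdG per-mode factor in logarithm: with `E = √(ξ² + D²)` and `β ≥ 0`,
`-βξ + βE - log 4 ≤ log(e^{-βξ}(1 + cosh(βE))/2) ≤ -βξ + βE`. [folklore] -/
theorem log_bdgModeFactor_mem_Icc {β : ℝ} (hβ : 0 ≤ β) (ξ D : ℝ) :
    Real.log (Real.exp (-(β * ξ)) * ((1 + Real.cosh (β * Real.sqrt (ξ ^ 2 + D ^ 2))) / 2)) ∈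
      Set.Icc (-(β * ξ) + β * Real.sqrt (ξ ^ 2 + D ^ 2) - Real.log 4)
        (-(β * ξ) + β * Real.sqrt (ξ ^ 2 + D ^ 2)) := by
  have hy : 0 ≤ β * Real.sqrt (ξ ^ 2 + D ^ 2) := mul_nonneg hβ (Real.sqrt_nonneg _)
  have hc : 0 < (1 + Real.cosh (β * Real.sqrt (ξ ^ 2 + D ^ 2))) / 2 := by
    have := Real.one_le_cosh (β * Real.sqrt (ξ ^ 2 + D ^ 2)); positivity
  rw [Real.log_mul (Real.exp_pos _).ne' hc.ne', Real.log_exp]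
  constructor
  · have h := exp_div_four_le_one_add_cosh_div_two (β * Real.sqrt (ξ ^ 2 + D ^ 2))
    have h' : Real.log (Real.exp (β * Real.sqrt (ξ ^ 2 + D ^ 2)) / 4) ≤
        Real.log ((1 + Real.cosh (β * Real.sqrt (ξ ^ 2 + D ^ 2))) / 2) :=
      Real.log_le_log (by positivity) h
    rw [Real.log_div (Real.exp_pos _).ne' (by norm_num), Real.log_exp] at h'
    linarith
  · have h := one_add_cosh_div_two_le_exp hy
    have h' : Real.log ((1 + Real.cosh (β * Real.sqrt (ξ ^ 2 + D ^ 2))) / 2) ≤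
        Real.log (Real.exp (β * Real.sqrt (ξ ^ 2 + D ^ 2))) :=
      Real.log_le_log hc h
    rw [Real.log_exp] at h'
    linarith

/-- Summing the per-mode bounds over a finite set of modes:
`-β Σ_k (ξ_k - E_k) - |ι| log 4 ≤ Σ_k log(e^{-βξ_k}(1 + cosh(βE_k))/2) ≤ -β Σ_k (ξ_k - E_k)`,
`E_k = √(ξ_k² + D_k²)`, `β ≥ 0`. [folklore] -/
theorem sum_log_bdgModeFactor_mem_Icc {ι : Type*} [Fintype ι] {β : ℝ} (hβ : 0 ≤ β) (ξ D : ι → ℝ) :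
    ∑ k, Real.log (Real.exp (-(β * ξ k)) * ((1 + Real.cosh (β * Real.sqrt (ξ k ^ 2 + D k ^ 2))) / 2)) ∈
      Set.Icc (-(β * ∑ k, (ξ k - Real.sqrt (ξ k ^ 2 + D k ^ 2))) - Fintype.card ι * Real.log 4)
        (-(β * ∑ k, (ξ k - Real.sqrt (ξ k ^ 2 + D k ^ 2)))) := by
  constructor
  · rw [Finset.mul_sum, ← Finset.sum_neg_distrib]
    have hc : (Fintype.card ι : ℝ) * Real.log 4 = ∑ _k : ι, Real.log 4 := by
      rw [Finset.sum_const, Finset.card_univ, nsmul_eq_mul]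
    rw [hc, ← Finset.sum_sub_distrib]
    refine Finset.sum_le_sum fun k _ => ?_
    have := (log_bdgModeFactor_mem_Icc hβ (ξ k) (D k)).1
    linarith
  · rw [Finset.mul_sum, ← Finset.sum_neg_distrib]
    refine Finset.sum_le_sum fun k _ => ?_
    have := (log_bdgModeFactor_mem_Icc hβ (ξ k) (D k)).2
    linarith

/-- **The sourced free partition function in logarithm**: for `L ≥ 3`, `β ≥ 0`,
`log Re Z_β(dWaveSourceTorus L 0 μ s) ∈ [2L² log 2 - β Σ_k (ξ_k - E_k) - L² log 4, 2L² log 2 - β Σ_k (ξ_k - E_k)]`,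
`ξ_k = ε_L(k) - μ`, `E_k = √(ξ_k² + 8s²ĝ_d(k)²)` (from the BdG formula
`partitionFn_dWaveSourceTorus_zero_re`). [cite: VondelftRalph2001, §4.2] -/
theorem log_partitionFn_dWaveSourceTorus_zero_mem_Icc (L : ℕ) [NeZero L] (hL : 3 ≤ L) {β : ℝ}
    (hβ : 0 ≤ β) (μ s : ℝ) :
    Real.log (partitionFn β (dWaveSourceTorus L 0 μ s)).re ∈
      Set.Icc
        (2 * (L : ℝ) ^ 2 * Real.log 2 -
            β * ∑ k : TorusSite 2 L, ((torusBand L k - μ) -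
              Real.sqrt ((torusBand L k - μ) ^ 2 + (2 * Real.sqrt 2 * s * dWaveGap k) ^ 2)) -
          (L : ℝ) ^ 2 * Real.log 4)
        (2 * (L : ℝ) ^ 2 * Real.log 2 -
          β * ∑ k : TorusSite 2 L, ((torusBand L k - μ) -
            Real.sqrt ((torusBand L k - μ) ^ 2 + (2 * Real.sqrt 2 * s * dWaveGap k) ^ 2))) := by
  rw [partitionFn_dWaveSourceTorus_zero_re hL β μ s, card_orb_fermionTorus_two]
  have hpow : (0 : ℝ) < (2 : ℝ) ^ (2 * L ^ 2) := by positivity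
  have hfac : ∀ k : TorusSite 2 L, Real.exp (-(β * (torusBand L k - μ))) *
      ((1 + Real.cosh (β * Real.sqrt ((torusBand L k - μ) ^ 2 +
        (2 * Real.sqrt 2 * s * dWaveGap k) ^ 2))) / 2) ≠ 0 :=
    fun k => (bdgModeFactor_pos β _ _).ne'
  rw [Real.log_mul hpow.ne' (Finset.prod_ne_zero_iff.2 fun k _ => hfac k),
    Real.log_prod (s := Finset.univ) (hf := fun k _ => hfac k), Real.log_pow]
  have hsum :
      ∑ k : TorusSite 2 L, Real.log (Real.exp (-(β * (torusBand L k - μ))) *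
          ((1 + Real.cosh (β * Real.sqrt ((torusBand L k - μ) ^ 2 +
            (2 * Real.sqrt 2 * s * dWaveGap k) ^ 2))) / 2)) ∈
        Set.Icc
          (-(β * ∑ k : TorusSite 2 L, ((torusBand L k - μ) -
                Real.sqrt ((torusBand L k - μ) ^ 2 + (2 * Real.sqrt 2 * s * dWaveGap k) ^ 2))) -
            Fintype.card (TorusSite 2 L) * Real.log 4)
          (-(β * ∑ k : TorusSite 2 L, ((torusBand L k - μ) -
            Real.sqrt ((torusBand L k - μ) ^ 2 + (2 * Real.sqrt 2 * s * dWaveGap k) ^ 2)))) :=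
    sum_log_bdgModeFactor_mem_Icc hβ (fun k : TorusSite 2 L => torusBand L k - μ)
      (fun k => 2 * Real.sqrt 2 * s * dWaveGap k)
  rw [card_torusSite_two] at hsum
  obtain ⟨hlo, hhi⟩ := hsum
  push_cast at hlo ⊢
  constructor
  · linarith
  · linarith

/-- **Stub `stub_freeSourcedGroundEnergy`** of the line `lro-seed-kink-bridge` (crux
`WcbcsBcsConstruction`): the grand-canonical ground energy of the FREE `d`-wave-sourced Hubbard torus
(`t = 1`, `U = 0`, `L ≥ 3`) is the BdG sum
`E₀(dWaveSourceTorus L 0 μ s) = Σ_{k ∈ (ℤ/Lℤ)²} (ξ_k - √(ξ_k² + 8s²ĝ_d(k)²))`, `ξ_k = ε_L(k) - μ`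
(from the partition function by `β → ∞`: `e^{-βE₀} ≤ Re Z_β ≤ 4^{L²} e^{-βE₀}`).
[cite: VondelftRalph2001, §4.2] -/
theorem stub_freeSourcedGroundEnergy :
    ∀ (L : ℕ) [NeZero L], 3 ≤ L → ∀ μ s : ℝ,
      (dWaveSourceTorus L 0 μ s).groundEnergy =
        ∑ k : TorusSite 2 L, ((torusBand L k - μ) -
          Real.sqrt ((torusBand L k - μ) ^ 2 + (2 * Real.sqrt 2 * s * dWaveGap k) ^ 2)) := by
  intro L _ hL μ s
  set H := dWaveSourceTorus L 0 μ s with hH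
  set S := ∑ k : TorusSite 2 L, ((torusBand L k - μ) -
    Real.sqrt ((torusBand L k - μ) ^ 2 + (2 * Real.sqrt 2 * s * dWaveGap k) ^ 2)) with hS
  have hHerm : H.IsHermitian := dWaveSourceTorus_isHermitian L (isHermitian_hubbardTorusWith L 1 0 μ) s
  have hcard : (Fintype.card (Finset (Orb (FermionTorus 2 L))) : ℝ) = (2 : ℝ) ^ (2 * L ^ 2) := by
    rw [Fintype.card_finset, card_orb_fermionTorus_two]; push_cast; ring
  -- for every β > 0: |E₀ - S| ≤ 2 L² log 2 / β
  have key : ∀ β : ℝ, 0 < β → H.groundEnergy ≤ S + 2 * (L : ℝ) ^ 2 * Real.log 2 / β ∧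
      S - 2 * (L : ℝ) ^ 2 * Real.log 2 / β ≤ H.groundEnergy := by
    intro β hβ
    have h1 := exp_neg_mul_groundEnergy_le_partitionFn hHerm β
    have h2 := partitionFn_le_card_mul_exp hHerm hβ.le
    have hZpos : 0 < (partitionFn β H).re := lt_of_lt_of_le (Real.exp_pos _) h1
    have hl1 : -(β * H.groundEnergy) ≤ Real.log (partitionFn β H).re := by
      rw [← Real.log_exp (-(β * H.groundEnergy))]
      exact Real.log_le_log (Real.exp_pos _) h1
    have hl2 : Real.log (partitionFn β H).re ≤ 2 * (L : ℝ) ^ 2 * Real.log 2 - β * H.groundEnergy := by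
      have h := Real.log_le_log hZpos h2
      rw [Real.log_mul (by positivity) (Real.exp_pos _).ne', Real.log_exp, hcard, Real.log_pow] at h
      push_cast at h
      linarith
    have hb := log_partitionFn_dWaveSourceTorus_zero_mem_Icc L hL hβ.le μ s
    rw [← hH, ← hS] at hb
    have hlog4 : Real.log 4 = 2 * Real.log 2 := by
      rw [show (4 : ℝ) = 2 ^ 2 by norm_num, Real.log_pow]; push_cast; ring
    rw [hlog4] at hb
    obtain ⟨hb1, hb2⟩ := hb
    constructor
    · have h : β * H.groundEnergy ≤ β * S + 2 * (L : ℝ) ^ 2 * Real.log 2 := by nlinarith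
      have h' : H.groundEnergy ≤ (β * S + 2 * (L : ℝ) ^ 2 * Real.log 2) / β := by
        rw [le_div_iff₀ hβ]; linarith
      calc H.groundEnergy ≤ (β * S + 2 * (L : ℝ) ^ 2 * Real.log 2) / β := h'
        _ = S + 2 * (L : ℝ) ^ 2 * Real.log 2 / β := by field_simp
    · have h : β * S - 2 * (L : ℝ) ^ 2 * Real.log 2 ≤ β * H.groundEnergy := by nlinarith
      have h' : (β * S - 2 * (L : ℝ) ^ 2 * Real.log 2) / β ≤ H.groundEnergy := by
        rw [div_le_iff₀ hβ]; linarith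
      calc S - 2 * (L : ℝ) ^ 2 * Real.log 2 / β
          = (β * S - 2 * (L : ℝ) ^ 2 * Real.log 2) / β := by field_simp
        _ ≤ H.groundEnergy := h'
  have hc : 0 ≤ 2 * (L : ℝ) ^ 2 * Real.log 2 := by
    have := Real.log_nonneg (show (1 : ℝ) ≤ 2 by norm_num); positivity
  refine le_antisymm ?_ ?_
  · refine le_of_forall_pos_le_add fun ε hε => ?_
    obtain ⟨h, -⟩ := key ((2 * (L : ℝ) ^ 2 * Real.log 2 + 1) / ε) (by positivity)
    calc H.groundEnergy
        ≤ S + 2 * (L : ℝ) ^ 2 * Real.log 2 / ((2 * (L : ℝ) ^ 2 * Real.log 2 + 1) / ε) := h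
      _ ≤ S + ε := by
          gcongr
          rw [div_div_eq_mul_div, div_le_iff₀ (by positivity)]
          nlinarith
  · refine le_of_forall_pos_le_add fun ε hε => ?_
    obtain ⟨-, h⟩ := key ((2 * (L : ℝ) ^ 2 * Real.log 2 + 1) / ε) (by positivity)
    have : 2 * (L : ℝ) ^ 2 * Real.log 2 / ((2 * (L : ℝ) ^ 2 * Real.log 2 + 1) / ε) ≤ ε := by
      rw [div_div_eq_mul_div, div_le_iff₀ (by positivity)]
      nlinarith
    linarith

end Summit.HubbardSuperconductivity.HubbardSuperconductivity.Theorems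

end
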